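import Summits.QuantumFields.YangMills.Theorems.WeakCouplingRatesDirichletCutoff
import Summits.QuantumFields.YangMills.Theorems.WeakCouplingRatesColdBoxTwoPointFloorWStubBoxKernelVsLattice

/-!
# Crux `ColdBoxTwoPointFloorW` (stmt-QuantumFields-19608): the temporal-gauge Dirichlet box kernel versus the free box kernel and
# the `ℤ⁴` kernel — `(4/5)·Π_H(T)² ≤ Π^D_H(T)²` eventually, for all exponents `0 < A < θ`

Route `WeakCouplingRates` (rev 2), line `birth`, fleet seat `ym-wcr-19608-p2`.  This file proves the CONTENT of the proposed stub S3c-iii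
`stub_boxKernelDirichletVsFree` of the v6/v7 re-cut of the birth skeleton (fleet lead `ym-wcr-19456-p1`, `pub/ym-fleet/ym-wcr-19456-p1/
Lines-birth-ColdBoxTwoPointFloorW.v6-proposal.lean`, not registered at the time of writing; the skeleton of record v5 has S3c =
`stub_boxGaussianDomination`), by name and with the proposed signature:

`stub_boxKernelDirichletVsFree : ∀ A θ : ℝ, 0 < A → A < θ → ∃ β₀ : ℝ, ∀ β : ℝ, β₀ ≤ β →
   4 / 5 * boxMaxwellPlaqCov ⌈β ^ θ⌉₊ ⌈β ^ A⌉₊ ^ 2 ≤ boxDirichletPlaqCov ⌈β ^ θ⌉₊ ⌈β ^ A⌉₊ ^ 2`.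

* `exists_boxDirichletPlaqCov_sub_bound` — **`|Π^D_H(T) − C(T)| ≤ K/H⁴`** for `H ≥ 32`, `T ≤ H/8` (`C = curvaturePlaquetteCorr 4`): the
  Dirichlet kernel of D1' is the projection onto curls of cold-box edge functions (forest gauge); the point mass splits as
  `δ_q = d₁(χφ_q) + div₃(χW_q) + V_q` with BOTH the potential `φ_q = div₂ g_q` and the co-potential `W_q = d₂ g_q` cut off by the ramp
  (`…DirichletHodge.lean`, `…DirichletCutoff.lean`), and the projection algebra of `…BoxProjection.lean` gives the error
  `Σ|d₁(χφ_p)||V_q| + ‖V_p‖‖V_q‖ = O(H⁴·H⁻⁸)`;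
* `exists_boxMaxwellPlaqCov_sub_bound` — the same for the free kernel (the estimate behind `stub_boxKernelVsLattice`, restated);
* `stub_boxKernelDirichletVsFree` — both kernels are within `C/20` of `C(T) ≥ T⁻⁴/(2π²)` once `H ≥ (1 + 40π²(K₁+K₂))·T`, which
  `H/T ≥ β^{θ−A}/2` guarantees eventually; `(4/5)(21/20)² ≤ (19/20)²`.

No sorry, standard axioms, no new definition, no named-fact hypothesis.  NOT a claim about the mass gap: a statement about Gaussian kernels.
-/

set_option autoImplicit false

noncomputable section

open Finset Matrix Real
open Literature.Probability.LatticeModels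
open Literature.MathematicalPhysics.QuantumLattice
open Literature.MathematicalPhysics.QuantumFieldTheory
open Literature.MathematicalPhysics.QuantumFieldTheory.LatticeMaxwell
open Literature.MathematicalPhysics.QuantumFieldTheory.AxialGauge
open Literature.MathematicalPhysics.QuantumFieldTheory.LatticeChain
open Literature.MathematicalPhysics.QuantumFieldTheory.LatticeForm (e d₀ d₁ d₂)

namespace Summit.QuantumFields.YangMills.Theorems.WeakCouplingRates

/-! ## The central plaquettes as labels of the enlarged box -/

/-- The labels (before translation by `dirCorner`) of the central `(1,2)`-plaquette and of its translate by `Te₀` are plaquette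
labels of the enlarged box `{0,…,2H+2}⁴`, and translate to `p_c`, `p_c + Te₀` (`T ≤ H + 1`). -/
theorem centre_labels_mem {H T : ℕ} (hT : T ≤ H + 1) :
    ((boxCentre H - dirCorner, 1, 2) : Plaq 4) ∈ plaquettesIn (halfOpenBox 4 (2 * H + 3)) ∧
      ((boxCentre H + Pi.single 0 (T : ℤ) - dirCorner, 1, 2) : Plaq 4) ∈ plaquettesIn (halfOpenBox 4 (2 * H + 3)) ∧
      Plaq.shift dirCorner ((boxCentre H - dirCorner, 1, 2) : Plaq 4) = plaq12At (boxCentre H) ∧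
      Plaq.shift dirCorner ((boxCentre H + Pi.single 0 (T : ℤ) - dirCorner, 1, 2) : Plaq 4) =
        plaq12At (boxCentre H + Pi.single 0 (T : ℤ)) := by
  have hT' : (T : ℤ) ≤ H + 1 := by exact_mod_cast hT
  have hmem : ∀ v : Site 4, (∀ m, 0 ≤ v m ∧ v m ≤ (H : ℤ) + 1) → boxCentre H - dirCorner + v ∈ halfOpenBox 4 (2 * H + 3) := by
    intro v hv
    rw [mem_halfOpenBox]
    intro m
    have := hv m
    simp only [Pi.add_apply, Pi.sub_apply, boxCentre, dirCorner]
    push_cast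
    constructor <;> omega
  have b0 : ∀ m : Fin 4, 0 ≤ (0 : Site 4) m ∧ (0 : Site 4) m ≤ (H : ℤ) + 1 := fun m => by simp; positivity
  have b1 : ∀ (i : Fin 4) (m : Fin 4), 0 ≤ (Pi.single i (1 : ℤ) : Site 4) m ∧ (Pi.single i (1 : ℤ) : Site 4) m ≤ (H : ℤ) + 1 := by
    intro i m; simp only [Pi.single_apply]; split_ifs <;> omega
  have b2 : ∀ (i j : Fin 4), i ≠ j → ∀ m : Fin 4, 0 ≤ (Pi.single i (1 : ℤ) + Pi.single j 1 : Site 4) m ∧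
      (Pi.single i (1 : ℤ) + Pi.single j 1 : Site 4) m ≤ (H : ℤ) + 1 := by
    intro i j hij m
    simp only [Pi.add_apply, Pi.single_apply]
    by_cases h1 : m = i
    · subst h1; simp [hij]
    · by_cases h2 : m = j
      · subst h2; simp [h1]
      · simp [h1, h2]; omega
  have bT : ∀ m : Fin 4, 0 ≤ (Pi.single 0 (T : ℤ) : Site 4) m ∧ (Pi.single 0 (T : ℤ) : Site 4) m ≤ (H : ℤ) + 1 := by
    intro m; simp only [Pi.single_apply]; split_ifs <;> omega
  have bT1 : ∀ (i : Fin 4), i ≠ 0 → ∀ m : Fin 4, 0 ≤ (Pi.single 0 (T : ℤ) + Pi.single i 1 : Site 4) m ∧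
      (Pi.single 0 (T : ℤ) + Pi.single i 1 : Site 4) m ≤ (H : ℤ) + 1 := by
    intro i hi m
    simp only [Pi.add_apply, Pi.single_apply]
    by_cases h1 : m = 0
    · subst h1; simp [hi.symm]; omega
    · by_cases h2 : m = i
      · subst h2; simp [h1]
      · simp [h1, h2]; omega
  have bT2 : ∀ m : Fin 4, 0 ≤ (Pi.single 0 (T : ℤ) + Pi.single 1 1 + Pi.single 2 1 : Site 4) m ∧
      (Pi.single 0 (T : ℤ) + Pi.single 1 1 + Pi.single 2 1 : Site 4) m ≤ (H : ℤ) + 1 := by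
    intro m
    simp only [Pi.add_apply, Pi.single_apply]
    by_cases h1 : m = 0
    · subst h1; simp; omega
    · by_cases h2 : m = 1
      · subst h2; simp
      · by_cases h3 : m = 2
        · subst h3; simp
        · simp [h1, h2, h3]; omega
  have hlt : (1 : Fin 4) < 2 := by decide
  have hc : boxCentre H - dirCorner ∈ halfOpenBox 4 (2 * H + 3) := by simpa using hmem 0 b0
  have e1 : boxCentre H + Pi.single 0 (T : ℤ) - dirCorner = boxCentre H - dirCorner + Pi.single 0 (T : ℤ) := by abel
  refine ⟨Plaq.mem_plaquettesIn.2 ⟨hc, hlt, hmem _ (b1 1), hmem _ (b1 2), ?_⟩,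
    Plaq.mem_plaquettesIn.2 ⟨?_, hlt, ?_, ?_, ?_⟩, ?_, ?_⟩
  · rw [add_assoc]; exact hmem _ (b2 1 2 (by decide))
  · rw [e1]; exact hmem _ bT
  · rw [e1, add_assoc]; exact hmem _ (bT1 1 (by decide))
  · rw [e1, add_assoc]; exact hmem _ (bT1 2 (by decide))
  · rw [e1, add_assoc, add_assoc]
    have : (Pi.single 0 (T : ℤ) + (Pi.single 1 1 + Pi.single 2 1) : Site 4) =
        Pi.single 0 (T : ℤ) + Pi.single 1 1 + Pi.single 2 1 := by abel
    rw [this]; exact hmem _ bT2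
  · simp only [Plaq.shift, plaq12At, sub_add_cancel]
  · simp only [Plaq.shift, plaq12At, sub_add_cancel]

/-- The number of plaquette labels of the enlarged box `{0,…,2H+2}⁴` is at most `1296 H⁴` (`H ≥ 3`). -/
theorem card_enlargedPlaquettes_le {H : ℕ} (hH : 3 ≤ H) :
    (#(plaquettesIn (halfOpenBox 4 (2 * H + 3))) : ℝ) ≤ 1296 * (H : ℝ) ^ 4 := by
  have h1 : (#(plaquettesIn (halfOpenBox 4 (2 * H + 3))) : ℝ) ≤ 4 * 4 * ((2 * H + 3 : ℕ) : ℝ) ^ 4 := by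
    exact_mod_cast AxialGauge.card_plaquettesIn_le (d := 4) (2 * H + 3)
  have h2 : ((2 * H + 3 : ℕ) : ℝ) ≤ 3 * H := by
    have : (3 : ℝ) ≤ H := by exact_mod_cast hH
    push_cast; linarith
  have h3 : ((2 * H + 3 : ℕ) : ℝ) ^ 4 ≤ (3 * (H : ℝ)) ^ 4 := pow_le_pow_left₀ (by positivity) h2 4
  nlinarith

/-! ## The Dirichlet kernel is the `ℤ⁴` kernel up to `O(H⁻⁴)` -/

/-- **The temporal-gauge Dirichlet box kernel is the `ℤ⁴` curvature kernel up to `O(H⁻⁴)`**: there is `K` with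
`|boxDirichletPlaqCov H T − curvaturePlaquetteCorr 4 T| ≤ K/H⁴` for all `H ≥ 32` and `T ≤ H/8`. -/
theorem exists_boxDirichletPlaqCov_sub_bound : ∃ K : ℝ, 0 ≤ K ∧ ∀ (H : ℕ), (32 : ℝ) ≤ H → ∀ (T : ℕ), (T : ℝ) ≤ (H : ℝ) / 8 →
    |boxDirichletPlaqCov H T - @Literature.MathematicalPhysics.QuantumFieldTheory.curvaturePlaquetteCorr 4 (by norm_num) (T : ℤ)| ≤
      K / (H : ℝ) ^ 4 := by
  obtain ⟨K_Z, hKZ0, hKZ⟩ := exists_curl_greenTensor_bound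
  obtain ⟨K_W, hKW0, hKW⟩ := exists_d₂_greenTensor_bound
  obtain ⟨K_φ, hKφ0, hKφ⟩ := exists_div₂_greenTensor_bound
  set K_A : ℝ := 256 * K_Z + 256 * K_φ with hKA
  set K_V : ℝ := 256 * K_φ + 512 * K_W with hKV
  have hKA0 : 0 ≤ K_A := by positivity
  have hKV0 : 0 ≤ K_V := by positivity
  refine ⟨1296 * (K_A * K_V + K_V ^ 2), by positivity, fun H hH T hTH => ?_⟩
  have hH0 : (0 : ℝ) < H := by linarith
  have hHn : 0 < H := by exact_mod_cast hH0
  have hH3 : 3 ≤ H := by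
    have : (3 : ℝ) ≤ H := by linarith
    exact_mod_cast this
  have hTH1 : T ≤ H + 1 := by
    have : (T : ℝ) ≤ H + 1 := by linarith
    exact_mod_cast this
  obtain ⟨hp, hq, hps, hqs⟩ := centre_labels_mem (H := H) hTH1
  set P := plaquettesIn (halfOpenBox 4 (2 * H + 3)) with hP
  set pL : Plaq 4 := (boxCentre H - dirCorner, 1, 2) with hpL
  set qL : Plaq 4 := (boxCentre H + Pi.single 0 (T : ℤ) - dirCorner, 1, 2) with hqL
  -- the kernel at the central pair
  have hker : boxDirichletPlaqCov H T =
      coeff (fun e => e ∉ dirFreeEdges H) dirCorner (2 * H + 3) (Plaq.shift dirCorner pL) ⬝ᵥ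
        (Qmat (fun e => e ∉ dirFreeEdges H) dirCorner (2 * H + 3))⁻¹ *ᵥ
          coeff (fun e => e ∉ dirFreeEdges H) dirCorner (2 * H + 3) (Plaq.shift dirCorner qL) := by
    rw [boxDirichletPlaqCov_eq_dotProduct, hps, hqs]
  have hmain := abs_dirKernel_sub_curl_le H hp hq (χ := boxCutoff H) (fun y hy => mem_halfOpenBox_of_boxCutoff_ne_zero y hy)
  rw [← hker, hqs, hps] at hmain
  -- the main term is `C(T)`: the centre lies on the plateau
  have hcentre : d₁ (fun x i => boxCutoff H x * div₂ (greenTensor (plaq12At (boxCentre H + Pi.single 0 (T : ℤ)))) x i)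
      (plaq12At (boxCentre H)).1 (plaq12At (boxCentre H)).2.1 (plaq12At (boxCentre H)).2.2 =
      @Literature.MathematicalPhysics.QuantumFieldTheory.curvaturePlaquetteCorr 4 (by norm_num) (T : ℤ) := by
    rw [← curl_greenTensor_centre H T]
    have h0 : ‖(plaq12At (boxCentre H)).1 - boxCentre H‖ ≤ (H : ℝ) / 2 - 2 := by
      simp only [plaq12At, sub_self, norm_zero]; linarith
    rw [d₁_cutoff_eq_of_plateau hHn _ h0]
    rfl
  rw [hcentre] at hmain
  -- distances of the two source plaquettes from the centre
  have hpc : ‖(plaq12At (boxCentre H)).1 - boxCentre H‖ ≤ (H : ℝ) / 8 := by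
    simp only [plaq12At, sub_self, norm_zero]; positivity
  have hqc : ‖(plaq12At (boxCentre H + Pi.single 0 (T : ℤ))).1 - boxCentre H‖ ≤ (H : ℝ) / 8 := by
    simp only [plaq12At, add_sub_cancel_left, Pi.norm_single, Int.norm_natCast]
    exact hTH
  -- pointwise bounds at the physical plaquettes
  have hKAH : 0 ≤ K_A / (H : ℝ) ^ 4 := div_nonneg hKA0 (pow_nonneg hH0.le 4)
  have hKVH : 0 ≤ K_V / (H : ℝ) ^ 4 := div_nonneg hKV0 (pow_nonneg hH0.le 4)
  have hV : ∀ (x : Plaq 4), ‖x.1 - boxCentre H‖ ≤ (H : ℝ) / 8 → ∀ y : Site 4, ∀ k l : Fin 4,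
      |d₁ (fun x' i => (1 - boxCutoff H x') * div₂ (greenTensor x) x' i) y k l +
          div₃ (fun y a b c => (1 - boxCutoff H y) * d₂ (greenTensor x) y a b c) y k l| ≤ K_V / (H : ℝ) ^ 4 := by
    intro x hx y k l
    by_cases hfar : (H : ℝ) / 2 - 2 < ‖y - boxCentre H‖
    · exact abs_dirRemainder_le hKφ0 hKW0 hKφ hKW hH hx hfar k l
    · rw [dirRemainder_eq_zero_of_plateau hHn x (not_lt.1 hfar), abs_zero]; exact hKVH
  have hAV : ∀ p' ∈ P,
      |d₁ (fun x i => boxCutoff H x * div₂ (greenTensor (plaq12At (boxCentre H))) x i)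
          (Plaq.shift dirCorner p').1 (Plaq.shift dirCorner p').2.1 (Plaq.shift dirCorner p').2.2| *
        |d₁ (fun x i => (1 - boxCutoff H x) * div₂ (greenTensor (plaq12At (boxCentre H + Pi.single 0 (T : ℤ)))) x i)
            (Plaq.shift dirCorner p').1 (Plaq.shift dirCorner p').2.1 (Plaq.shift dirCorner p').2.2 +
          div₃ (fun y a b c => (1 - boxCutoff H y) * d₂ (greenTensor (plaq12At (boxCentre H + Pi.single 0 (T : ℤ)))) y a b c)
            (Plaq.shift dirCorner p').1 (Plaq.shift dirCorner p').2.1 (Plaq.shift dirCorner p').2.2| ≤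
        (K_A / (H : ℝ) ^ 4) * (K_V / (H : ℝ) ^ 4) := by
    intro p' _
    by_cases hfar : (H : ℝ) / 2 - 2 < ‖(Plaq.shift dirCorner p').1 - boxCentre H‖
    · exact mul_le_mul (abs_d₁_cutoff_le hKZ0 hKφ0 hKZ hKφ hH hpc hfar _ _) (hV _ hqc _ _ _) (abs_nonneg _) hKAH
    · rw [dirRemainder_eq_zero_of_plateau hHn _ (not_lt.1 hfar), abs_zero, mul_zero]; exact mul_nonneg hKAH hKVH
  have hcard := card_enlargedPlaquettes_le hH3
  have hnsmul : (#P • ((K_A / (H : ℝ) ^ 4) * (K_V / (H : ℝ) ^ 4)) : ℝ) ≤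
      1296 * (H : ℝ) ^ 4 * ((K_A / (H : ℝ) ^ 4) * (K_V / (H : ℝ) ^ 4)) := by
    rw [nsmul_eq_mul]; exact mul_le_mul_of_nonneg_right hcard (mul_nonneg hKAH hKVH)
  have hsum1 := (Finset.sum_le_card_nsmul _ _ _ hAV).trans hnsmul
  have hsq : ∀ (x : Plaq 4), ‖x.1 - boxCentre H‖ ≤ (H : ℝ) / 8 →
      ∑ p' ∈ P, (d₁ (fun x' i => (1 - boxCutoff H x') * div₂ (greenTensor x) x' i)
            (Plaq.shift dirCorner p').1 (Plaq.shift dirCorner p').2.1 (Plaq.shift dirCorner p').2.2 +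
          div₃ (fun y a b c => (1 - boxCutoff H y) * d₂ (greenTensor x) y a b c)
            (Plaq.shift dirCorner p').1 (Plaq.shift dirCorner p').2.1 (Plaq.shift dirCorner p').2.2) ^ 2 ≤
        1296 * (H : ℝ) ^ 4 * (K_V / (H : ℝ) ^ 4) ^ 2 := by
    intro x hx
    have hterm : ∀ p' ∈ P, (d₁ (fun x' i => (1 - boxCutoff H x') * div₂ (greenTensor x) x' i)
            (Plaq.shift dirCorner p').1 (Plaq.shift dirCorner p').2.1 (Plaq.shift dirCorner p').2.2 +
          div₃ (fun y a b c => (1 - boxCutoff H y) * d₂ (greenTensor x) y a b c)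
            (Plaq.shift dirCorner p').1 (Plaq.shift dirCorner p').2.1 (Plaq.shift dirCorner p').2.2) ^ 2 ≤
          (K_V / (H : ℝ) ^ 4) ^ 2 := by
      intro p' _
      rw [← sq_abs]
      exact pow_le_pow_left₀ (abs_nonneg _) (hV x hx _ _ _) 2
    refine (Finset.sum_le_card_nsmul _ _ _ hterm).trans ?_
    rw [nsmul_eq_mul]
    exact mul_le_mul_of_nonneg_right hcard (pow_nonneg hKVH 2)
  set B := 1296 * (H : ℝ) ^ 4 * (K_V / (H : ℝ) ^ 4) ^ 2 with hB
  have hB0 : 0 ≤ B := mul_nonneg (by positivity) (pow_nonneg hKVH 2)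
  have hsum2 : Real.sqrt (∑ p' ∈ P, (d₁ (fun x' i => (1 - boxCutoff H x') * div₂ (greenTensor (plaq12At (boxCentre H))) x' i)
            (Plaq.shift dirCorner p').1 (Plaq.shift dirCorner p').2.1 (Plaq.shift dirCorner p').2.2 +
          div₃ (fun y a b c => (1 - boxCutoff H y) * d₂ (greenTensor (plaq12At (boxCentre H))) y a b c)
            (Plaq.shift dirCorner p').1 (Plaq.shift dirCorner p').2.1 (Plaq.shift dirCorner p').2.2) ^ 2) *
      Real.sqrt (∑ p' ∈ P, (d₁ (fun x' i => (1 - boxCutoff H x') *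
              div₂ (greenTensor (plaq12At (boxCentre H + Pi.single 0 (T : ℤ)))) x' i)
            (Plaq.shift dirCorner p').1 (Plaq.shift dirCorner p').2.1 (Plaq.shift dirCorner p').2.2 +
          div₃ (fun y a b c => (1 - boxCutoff H y) * d₂ (greenTensor (plaq12At (boxCentre H + Pi.single 0 (T : ℤ)))) y a b c)
            (Plaq.shift dirCorner p').1 (Plaq.shift dirCorner p').2.1 (Plaq.shift dirCorner p').2.2) ^ 2) ≤ B := by
    calc _ ≤ Real.sqrt B * Real.sqrt B :=
          mul_le_mul (Real.sqrt_le_sqrt (hsq _ hpc)) (Real.sqrt_le_sqrt (hsq _ hqc)) (Real.sqrt_nonneg _) (Real.sqrt_nonneg _)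
      _ = B := Real.mul_self_sqrt hB0
  refine hmain.trans ((add_le_add hsum1 hsum2).trans (le_of_eq ?_))
  rw [hB]
  field_simp

/-- **The free box kernel is the `ℤ⁴` kernel up to `O(H⁻⁴)`** (the estimate behind `stub_boxKernelVsLattice`, in absolute form):
`|boxMaxwellPlaqCov H T − curvaturePlaquetteCorr 4 T| ≤ K/H⁴` for `H ≥ 32`, `T ≤ H/8`. -/
theorem exists_boxMaxwellPlaqCov_sub_bound : ∃ K : ℝ, 0 ≤ K ∧ ∀ (H : ℕ), (32 : ℝ) ≤ H → ∀ (T : ℕ), (T : ℝ) ≤ (H : ℝ) / 8 →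
    |boxMaxwellPlaqCov H T - @Literature.MathematicalPhysics.QuantumFieldTheory.curvaturePlaquetteCorr 4 (by norm_num) (T : ℤ)| ≤
      K / (H : ℝ) ^ 4 := by
  obtain ⟨K, hK0, hK⟩ := exists_boxProjKernel_sub_curl_bound
  refine ⟨K, hK0, fun H hH T hTH => ?_⟩
  have hH1 : 1 ≤ H := by
    have : (1 : ℝ) ≤ H := by linarith
    exact_mod_cast this
  have hTH' : T ≤ H := by
    have : (T : ℝ) ≤ H := by linarith [show (0 : ℝ) ≤ H by positivity]
    exact_mod_cast this
  obtain ⟨hp, hq⟩ := plaq12At_centre_mem hH1 hTH'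
  have hker : boxMaxwellPlaqCov H T = boxProjKernel H (plaq12At (boxCentre H)) (plaq12At (boxCentre H + Pi.single 0 (T : ℤ))) := by
    rw [boxMaxwellPlaqCov_eq_dotProduct]; rfl
  have hpc : ‖(plaq12At (boxCentre H)).1 - boxCentre H‖ ≤ (H : ℝ) / 8 := by
    simp only [plaq12At, sub_self, norm_zero]; positivity
  have hqc : ‖(plaq12At (boxCentre H + Pi.single 0 (T : ℤ))).1 - boxCentre H‖ ≤ (H : ℝ) / 8 := by
    simp only [plaq12At, add_sub_cancel_left, Pi.norm_single, Int.norm_natCast]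
    exact hTH
  have herr := hK H hH _ _ hp hq hpc hqc
  rw [← hker] at herr
  have hcentre : d₁ (div₂ (greenTensor (plaq12At (boxCentre H + Pi.single 0 (T : ℤ))))) (plaq12At (boxCentre H)).1
      (plaq12At (boxCentre H)).2.1 (plaq12At (boxCentre H)).2.2 =
      @Literature.MathematicalPhysics.QuantumFieldTheory.curvaturePlaquetteCorr 4 (by norm_num) (T : ℤ) :=
    curl_greenTensor_centre H T
  rwa [hcentre] at herr

/-! ## The comparison of the two box kernels: `(4/5)·Π² ≤ Π_D²` eventually, for all exponents -/

/-- **The deterministic comparison.**  If `|a − C| ≤ C/20`, `|b − C| ≤ C/20` (`C ≥ 0`) then `(4/5)a² ≤ b²`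
(`(4/5)(21/20)² = 0.882 ≤ (19/20)² = 0.9025`). -/
theorem four_fifths_sq_le_sq {a b C : ℝ} (hC : 0 ≤ C) (h1 : |a - C| ≤ C / 20) (h2 : |b - C| ≤ C / 20) :
    4 / 5 * a ^ 2 ≤ b ^ 2 := by
  rw [abs_le] at h1 h2
  have ha0 : 0 ≤ a := by linarith
  have ha : a ≤ 21 / 20 * C := by linarith
  have hb : 19 / 20 * C ≤ b := by linarith
  have hb0 : 0 ≤ 19 / 20 * C := by positivity
  have hsq1 : a ^ 2 ≤ (21 / 20 * C) ^ 2 := pow_le_pow_left₀ ha0 ha 2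
  have hsq2 : (19 / 20 * C) ^ 2 ≤ b ^ 2 := pow_le_pow_left₀ hb0 hb 2
  nlinarith [sq_nonneg C]

/-- **The free and the Dirichlet box kernels agree to leading order at depth `T = ⌈β^A⌉ ≪ H = ⌈β^θ⌉`** (content of the proposed
stub S3c-iii `stub_boxKernelDirichletVsFree` of the v6/v7 re-cut of the birth skeleton of `ColdBoxTwoPointFloorW`; pure Gaussian,
all exponents `0 < A < θ`): eventually `(4/5)·boxMaxwellPlaqCov(H,T)² ≤ boxDirichletPlaqCov(H,T)²`.  Both kernels are within `K/H⁴` of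
`C(T) = T⁻⁴/π² + O(T⁻⁵)` (`exists_boxMaxwellPlaqCov_sub_bound`, `exists_boxDirichletPlaqCov_sub_bound`, `exists_curvaturePlaquetteCorr_asymp`)
and `H/T ≥ β^{θ−A}/2 → ∞`. -/
theorem stub_boxKernelDirichletVsFree : ∀ A θ : ℝ, 0 < A → A < θ → ∃ β₀ : ℝ, ∀ β : ℝ, β₀ ≤ β → 4 / 5 * boxMaxwellPlaqCov ⌈β ^ θ⌉₊ ⌈β ^ A⌉₊ ^ 2 ≤ boxDirichletPlaqCov ⌈β ^ θ⌉₊ ⌈β ^ A⌉₊ ^ 2 := by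
  intro A θ hA hAθ
  obtain ⟨K₁, hK10, hE1⟩ := exists_boxMaxwellPlaqCov_sub_bound
  obtain ⟨K₂, hK20, hE2⟩ := exists_boxDirichletPlaqCov_sub_bound
  obtain ⟨K_C, hKC0, hC⟩ := exists_curvaturePlaquetteCorr_asymp
  have hθ : 0 < θ := hA.trans hAθ
  have hθA : 0 < θ - A := by linarith
  set M : ℝ := 1 + 40 * π ^ 2 * (K₁ + K₂) with hM
  have hM0 : 0 ≤ 40 * π ^ 2 * (K₁ + K₂) := by positivity
  have hM1 : 1 ≤ M := by linarith
  set L : ℝ := 2 * π ^ 2 * K_C + 1 with hL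
  have hL0 : 0 ≤ 2 * π ^ 2 * K_C := by positivity
  have hL1 : 1 ≤ L := by linarith
  set β₀ : ℝ := max (max 1 ((32 : ℝ) ^ (1 / θ))) (max ((16 * M) ^ (1 / (θ - A))) (L ^ (1 / A))) with hβ₀
  refine ⟨β₀, fun β hβ => ?_⟩
  have hβ1 : 1 ≤ β := le_trans (le_trans (le_max_left _ _) (le_max_left _ _)) hβ
  have hθpow : (32 : ℝ) ≤ β ^ θ :=
    le_rpow_of_root_le (by norm_num) hθ (le_trans (le_trans (le_max_right _ _) (le_max_left _ _)) hβ)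
  have hdiff : 16 * M ≤ β ^ (θ - A) :=
    le_rpow_of_root_le (by positivity) hθA (le_trans (le_trans (le_max_left _ _) (le_max_right _ _)) hβ)
  have hApow : L ≤ β ^ A :=
    le_rpow_of_root_le (by positivity) hA (le_trans (le_trans (le_max_right _ _) (le_max_right _ _)) hβ)
  have hA1 : 1 ≤ β ^ A := hL1.trans hApow
  have hsplit : β ^ θ = β ^ (θ - A) * β ^ A := by
    rw [← Real.rpow_add (by linarith)]; ring_nf
  set T : ℕ := ⌈β ^ A⌉₊ with hT
  set H : ℕ := ⌈β ^ θ⌉₊ with hH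
  have hT_ge : β ^ A ≤ (T : ℝ) := Nat.le_ceil _
  have hT_lt : (T : ℝ) < β ^ A + 1 := Nat.ceil_lt_add_one (by positivity)
  have hT_le : (T : ℝ) ≤ 2 * β ^ A := by linarith
  have hH_ge : β ^ θ ≤ (H : ℝ) := Nat.le_ceil _
  have hT1 : 1 ≤ T := by
    have : (1 : ℝ) ≤ T := hA1.trans hT_ge
    exact_mod_cast this
  have hT0 : (0 : ℝ) < T := by exact_mod_cast hT1
  have hH32 : (32 : ℝ) ≤ H := hθpow.trans hH_ge
  have hH0 : (0 : ℝ) < H := by linarith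
  have hHT : M * (T : ℝ) ≤ (H : ℝ) / 8 := by
    have h1 : M * (T : ℝ) ≤ M * (2 * β ^ A) := mul_le_mul_of_nonneg_left hT_le (by linarith)
    have h2 : 16 * M * β ^ A ≤ β ^ (θ - A) * β ^ A := mul_le_mul_of_nonneg_right hdiff (by linarith)
    rw [← hsplit] at h2
    linarith
  have hTH : (T : ℝ) ≤ (H : ℝ) / 8 := by
    have : (T : ℝ) ≤ M * T := le_mul_of_one_le_left hT0.le hM1
    linarith
  -- the curvature number and its lower bound
  set C := @Literature.MathematicalPhysics.QuantumFieldTheory.curvaturePlaquetteCorr 4 (by norm_num) (T : ℤ) with hCdef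
  have hasy := hC T hT1
  have hCT : K_C / (T : ℝ) ^ 5 ≤ (1 / π ^ 2 / (T : ℝ) ^ 4) / 2 := by
    have hLT : L ≤ (T : ℝ) := hApow.trans hT_ge
    have hKT : 2 * π ^ 2 * K_C ≤ (T : ℝ) := by linarith
    have e : (1 / π ^ 2 / (T : ℝ) ^ 4) / 2 = 1 / (2 * π ^ 2) / (T : ℝ) ^ 4 := by field_simp
    rw [e, div_le_div_iff₀ (by positivity) (by positivity)]
    calc K_C * (T : ℝ) ^ 4 = (2 * π ^ 2 * K_C) * (T : ℝ) ^ 4 * (1 / (2 * π ^ 2)) := by field_simp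
      _ ≤ (T : ℝ) * (T : ℝ) ^ 4 * (1 / (2 * π ^ 2)) := by gcongr
      _ = 1 / (2 * π ^ 2) * (T : ℝ) ^ 5 := by ring
  have hClow : (1 / π ^ 2 / (T : ℝ) ^ 4) / 2 ≤ C := by
    rw [abs_le] at hasy; linarith [hasy.1]
  have hC0 : 0 ≤ C := le_trans (by positivity) hClow
  -- the two kernel errors are `≤ C/20`
  have herrK : ∀ {K : ℝ}, 0 ≤ K → K ≤ K₁ + K₂ → K / (H : ℝ) ^ 4 ≤ C / 20 := by
    intro K hK0 hKle
    have hMT : M * (T : ℝ) ≤ H := by linarith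
    have hMT4 : (M * (T : ℝ)) ^ 4 ≤ (H : ℝ) ^ 4 := pow_le_pow_left₀ (by positivity) hMT 4
    have hM4 : 40 * π ^ 2 * K ≤ M ^ 4 := by
      have : M ≤ M ^ 4 := by
        calc M = M ^ 1 := (pow_one M).symm
          _ ≤ M ^ 4 := pow_le_pow_right₀ hM1 (by norm_num)
      nlinarith [Real.pi_pos]
    have hstep : K / (H : ℝ) ^ 4 ≤ 1 / (40 * π ^ 2) / (T : ℝ) ^ 4 := by
      rw [div_le_div_iff₀ (by positivity) (by positivity)]
      calc K * (T : ℝ) ^ 4 = (40 * π ^ 2 * K) * (T : ℝ) ^ 4 * (1 / (40 * π ^ 2)) := by field_simp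
        _ ≤ M ^ 4 * (T : ℝ) ^ 4 * (1 / (40 * π ^ 2)) := by gcongr
        _ = 1 / (40 * π ^ 2) * (M * (T : ℝ)) ^ 4 := by ring
        _ ≤ 1 / (40 * π ^ 2) * (H : ℝ) ^ 4 := mul_le_mul_of_nonneg_left hMT4 (by positivity)
    have e : 1 / (40 * π ^ 2) / (T : ℝ) ^ 4 = ((1 / π ^ 2 / (T : ℝ) ^ 4) / 2) / 20 := by field_simp; ring
    rw [e] at hstep
    exact hstep.trans (by linarith)
  have h1 := (hE1 H hH32 T hTH).trans (herrK hK10 (by linarith))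
  have h2 := (hE2 H hH32 T hTH).trans (herrK hK20 (by linarith))
  exact four_fifths_sq_le_sq hC0 h1 h2

end Summit.QuantumFields.YangMills.Theorems.WeakCouplingRates

end
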